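/-
Copyright (c) 2026 The H21 project. Released under Apache 2.0 license.
-/
import Summits.RiemannHypothesis.RiemannHypothesis.Theorems.PfPersistenceGalerkinInertia
import Summits.RiemannHypothesis.RiemannHypothesis.Theorems.GroundBartaEvenWinsBeyondArchDeflationPSD
import Summits.RiemannHypothesis.RiemannHypothesis.Theorems.PfPersistenceResolventSign
import HarnessLib

/-!
# `P_F` persistence — GAL-6: INDEX ENCLOSURE — the window index from entrywise enclosures (cand-3, gen 12)

Mechanism / rigidity campaign of the `pub-rhpf` cell (variational seat M2 = cand-3); NO claim about RH is made
anywhere in this file.  Everything here is RH-free and sorry-free; no numerical datum is used (all PROVED): the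
entrywise enclosure `|M i j − P i j| ≤ E i j` is a HYPOTHESIS (what a validated-numerics seat produces), never an
assertion about `ζ`.

GAL-5 (`PfPersistenceGalerkinInertia`) reads the Galerkin negative index of an EXACTLY known symmetric matrix as a
count of negative pivots / eigenvalues.  Window matrices of `ζ` are only known through ENCLOSURES.  This file is the
glue: a two-sided, kernel-checked enclosure of the index of the true matrix `M` by the exact indices of the two
matrices `P ± δ·1` (Weyl's inequality in index form, proved by frame transport — no eigenvalue perturbation theory).

* §1 ANTI-MONOTONICITY `HasNegFrame.anti` : if `xᵀ M x ≤ xᵀ M' x` for all `x`, negative frames of `M'` are negative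
  frames of `M`.
* §2 NEARNESS ⇒ FORM SANDWICH `form_sub_le_of_near` / `form_le_add_of_near` : from `|M − P| ≤ E` entrywise with
  row and column sums of `E` at most `δ` (the Gershgorin / Schur-test budget of `dt_quadForm_nonneg_of_near`,
  [cite: Rump2006PosDef, §2]): `xᵀ P x − δ‖x‖² ≤ xᵀ M x ≤ xᵀ P x + δ‖x‖²`.
* §3 **INDEX ENCLOSURE** `HasNegFrame.of_near_add` / `HasNegFrame.near_sub` :
  `HasNegFrame (P + δ·1) n → HasNegFrame M n → HasNegFrame (P − δ·1) n`; with GAL-5's Sylvester reading, exact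
  unit-determinant factorisations `P ± δ·1 = L± · diag D± · L±ᵀ` give
  `#{D⁺ < 0} ≤ (index of M) ≤ #{D⁻ < 0}` (`hasNegFrame_of_near_pivots`, `le_card_neg_pivots_of_near`).
* §4 DICTIONARY at a window: `natCast_le_galerkinNegIndex_of_near`, `galerkinNegIndex_le_of_near`, and the PINNING
  `galerkinNegIndex_eq_of_near` (both certificates count `k` ⇒ `galerkinNegIndex d win = k`); positivity as the case
  `k = 0` (`windowPositive_of_near`).
* §5 At `ζ` (through GAL-4's unconditional ladder): an enclosure of `A^{(N)}(a)` plus an exact certificate of `k`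
  negative pivots for `P + δ·1` reads `k ≤ #𝒬` (`natCast_le_encard_of_near_pivots`) — a statement about off-line
  zero quadruples from finite data, RH-free; no such certificate is asserted here.
-/

set_option linter.dupNamespace false

noncomputable section

open Matrix Finset Module

namespace Summit.RiemannHypothesis.RiemannHypothesis.Theorems.PfPersistence

open Summit.RiemannHypothesis.RiemannHypothesis.Theorems.EvenWinsBeyondArch (dt_quadForm_nonneg_of_near)
open Literature.NumberTheory.LFunctions Literature.NumberTheory.LFunctions.WeilContinuous
open Literature.NumberTheory.LFunctions.ZetaZeros

/-! ## §1 Anti-monotonicity of negative frames in the form -/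

/-- **PROVED — ANTI-MONOTONICITY.** If `xᵀ M x ≤ xᵀ M' x` for every `x`, then every negative `n`-frame of `M'` is a
negative `n`-frame of `M`. [folklore] -/
theorem HasNegFrame.anti {m n : ℕ} {M M' : Matrix (Fin m) (Fin m) ℝ} (hle : ∀ x, x ⬝ᵥ (M *ᵥ x) ≤ x ⬝ᵥ (M' *ᵥ x))
    (h : HasNegFrame M' n) : HasNegFrame M n := by
  obtain ⟨v, hv⟩ := h
  exact ⟨v, fun c hc ↦ (hle _).trans_lt (hv c hc)⟩

/-- PROVED: the quadratic form of `P + δ·1` (the `P − δ·1` twin is `form_sub_smul_one` of `PfPersistenceResolventSign`).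
[folklore] -/
theorem form_add_smul_one {m : ℕ} (P : Matrix (Fin m) (Fin m) ℝ) (δ : ℝ) (x : Fin m → ℝ) :
    x ⬝ᵥ ((P + δ • (1 : Matrix (Fin m) (Fin m) ℝ)) *ᵥ x) = x ⬝ᵥ (P *ᵥ x) + δ * (x ⬝ᵥ x) := by
  rw [Matrix.add_mulVec, dotProduct_add, Matrix.smul_mulVec, Matrix.one_mulVec, dotProduct_smul, smul_eq_mul]

/-! ## §2 Entrywise nearness ⇒ two-sided form sandwich -/

/-- **PROVED — LOWER FORM BOUND from an enclosure.** `|M − P| ≤ E` entrywise with row/column sums of `E` at most `δ`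
gives `xᵀ P x − δ‖x‖² ≤ xᵀ M x` (the perturbation half of [cite: Rump2006PosDef, §2], via
`dt_quadForm_nonneg_of_near`). [folklore] -/
theorem form_sub_le_of_near {m : ℕ} {M P E : Matrix (Fin m) (Fin m) ℝ} {δ : ℝ} (hE : ∀ i j, |M i j - P i j| ≤ E i j)
    (hrow : ∀ i, ∑ j, E i j ≤ δ) (hcol : ∀ j, ∑ i, E i j ≤ δ) (x : Fin m → ℝ) :
    x ⬝ᵥ (P *ᵥ x) - δ * (x ⬝ᵥ x) ≤ x ⬝ᵥ (M *ᵥ x) := by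
  have hform : ∀ A : Matrix (Fin m) (Fin m) ℝ, x ⬝ᵥ (A *ᵥ x) = ∑ i, ∑ j, x i * x j * A i j := fun A ↦ by
    simp only [dotProduct, Matrix.mulVec, Finset.mul_sum]
    exact Finset.sum_congr rfl fun i _ ↦ Finset.sum_congr rfl fun j _ ↦ by ring
  -- apply the perturbation lemma to `M − P + δ·1` against `δ·1`
  have h := dt_quadForm_nonneg_of_near (fun i j ↦ (M - P + δ • (1 : Matrix (Fin m) (Fin m) ℝ)) i j)
    (fun i j ↦ (δ • (1 : Matrix (Fin m) (Fin m) ℝ)) i j) (fun i j ↦ E i j) δ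
    (fun i j ↦ by simpa using hE i j) hrow hcol (fun α ↦ ?_) x
  · have h2 : ∑ i, ∑ j, x i * x j * (M - P + δ • (1 : Matrix (Fin m) (Fin m) ℝ)) i j =
        x ⬝ᵥ (M *ᵥ x) - x ⬝ᵥ (P *ᵥ x) + δ * (x ⬝ᵥ x) := by
      rw [← hform, Matrix.add_mulVec, Matrix.sub_mulVec, dotProduct_add, dotProduct_sub, Matrix.smul_mulVec,
        Matrix.one_mulVec, dotProduct_smul, smul_eq_mul]
    rw [h2] at h
    linarith
  · have h3 : ∑ i, ∑ j, α i * α j * (δ • (1 : Matrix (Fin m) (Fin m) ℝ)) i j = δ * ∑ i, α i ^ 2 := by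
      simp only [Matrix.smul_apply, Matrix.one_apply, smul_eq_mul, mul_ite, mul_one, mul_zero, Finset.sum_ite_eq,
        Finset.mem_univ, if_true, Finset.mul_sum]
      exact Finset.sum_congr rfl fun i _ ↦ by ring
    rw [h3]

/-- **PROVED — UPPER FORM BOUND from an enclosure:** `xᵀ M x ≤ xᵀ P x + δ‖x‖²` (the enclosure hypothesis is
symmetric in `M ↔ P`). [folklore] -/
theorem form_le_add_of_near {m : ℕ} {M P E : Matrix (Fin m) (Fin m) ℝ} {δ : ℝ} (hE : ∀ i j, |M i j - P i j| ≤ E i j)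
    (hrow : ∀ i, ∑ j, E i j ≤ δ) (hcol : ∀ j, ∑ i, E i j ≤ δ) (x : Fin m → ℝ) :
    x ⬝ᵥ (M *ᵥ x) ≤ x ⬝ᵥ (P *ᵥ x) + δ * (x ⬝ᵥ x) := by
  have h := form_sub_le_of_near (M := P) (P := M) (fun i j ↦ by rw [abs_sub_comm]; exact hE i j) hrow hcol x
  linarith

/-- PROVED: the sandwich in matrix form — `xᵀ (P − δ·1) x ≤ xᵀ M x ≤ xᵀ (P + δ·1) x`. [folklore] -/
theorem form_near_sandwich {m : ℕ} {M P E : Matrix (Fin m) (Fin m) ℝ} {δ : ℝ} (hE : ∀ i j, |M i j - P i j| ≤ E i j)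
    (hrow : ∀ i, ∑ j, E i j ≤ δ) (hcol : ∀ j, ∑ i, E i j ≤ δ) (x : Fin m → ℝ) :
    x ⬝ᵥ ((P - δ • (1 : Matrix (Fin m) (Fin m) ℝ)) *ᵥ x) ≤ x ⬝ᵥ (M *ᵥ x) ∧
      x ⬝ᵥ (M *ᵥ x) ≤ x ⬝ᵥ ((P + δ • (1 : Matrix (Fin m) (Fin m) ℝ)) *ᵥ x) := by
  rw [form_sub_smul_one, form_add_smul_one]
  exact ⟨form_sub_le_of_near hE hrow hcol x, form_le_add_of_near hE hrow hcol x⟩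

/-! ## §3 The index enclosure -/

/-- **PROVED — INDEX ENCLOSURE, lower half:** a negative `n`-frame of `P + δ·1` is a negative `n`-frame of every `M`
enclosed by `(P, E)` with budget `δ`. [folklore] -/
theorem HasNegFrame.of_near_add {m n : ℕ} {M P E : Matrix (Fin m) (Fin m) ℝ} {δ : ℝ}
    (hE : ∀ i j, |M i j - P i j| ≤ E i j) (hrow : ∀ i, ∑ j, E i j ≤ δ) (hcol : ∀ j, ∑ i, E i j ≤ δ)
    (h : HasNegFrame (P + δ • (1 : Matrix (Fin m) (Fin m) ℝ)) n) : HasNegFrame M n :=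
  h.anti fun x ↦ (form_near_sandwich hE hrow hcol x).2

/-- **PROVED — INDEX ENCLOSURE, upper half:** a negative `n`-frame of an enclosed `M` is a negative `n`-frame of
`P − δ·1`. [folklore] -/
theorem HasNegFrame.near_sub {m n : ℕ} {M P E : Matrix (Fin m) (Fin m) ℝ} {δ : ℝ}
    (hE : ∀ i j, |M i j - P i j| ≤ E i j) (hrow : ∀ i, ∑ j, E i j ≤ δ) (hcol : ∀ j, ∑ i, E i j ≤ δ)
    (h : HasNegFrame M n) : HasNegFrame (P - δ • (1 : Matrix (Fin m) (Fin m) ℝ)) n :=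
  h.anti fun x ↦ (form_near_sandwich hE hrow hcol x).1

/-- **PROVED — CERTIFIED LOWER INDEX BOUND:** an enclosure `(P, E, δ)` of `M` and an exact unit-determinant
factorisation `P + δ·1 = L · diag D · Lᵀ` with at least `n` negative pivots give a negative `n`-frame of `M`
(GAL-5's Sylvester reading `hasNegFrame_iff_card_neg_pivots`). [folklore] -/
theorem hasNegFrame_of_near_pivots {m n : ℕ} {M P E L : Matrix (Fin m) (Fin m) ℝ} {δ : ℝ} {D : Fin m → ℝ}
    (hE : ∀ i j, |M i j - P i j| ≤ E i j) (hrow : ∀ i, ∑ j, E i j ≤ δ) (hcol : ∀ j, ∑ i, E i j ≤ δ)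
    (hL : IsUnit L.det) (hfac : P + δ • (1 : Matrix (Fin m) (Fin m) ℝ) = L * Matrix.diagonal D * Lᵀ)
    (hn : n ≤ Fintype.card {i // D i < 0}) : HasNegFrame M n :=
  HasNegFrame.of_near_add hE hrow hcol ((hasNegFrame_iff_card_neg_pivots hL hfac).2 hn)

/-- **PROVED — CERTIFIED UPPER INDEX BOUND:** an enclosure `(P, E, δ)` of `M` and an exact unit-determinant
factorisation `P − δ·1 = L · diag D · Lᵀ` bound every negative frame of `M` by the number of negative pivots.
[folklore] -/
theorem le_card_neg_pivots_of_near {m n : ℕ} {M P E L : Matrix (Fin m) (Fin m) ℝ} {δ : ℝ} {D : Fin m → ℝ}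
    (hE : ∀ i j, |M i j - P i j| ≤ E i j) (hrow : ∀ i, ∑ j, E i j ≤ δ) (hcol : ∀ j, ∑ i, E i j ≤ δ)
    (hL : IsUnit L.det) (hfac : P - δ • (1 : Matrix (Fin m) (Fin m) ℝ) = L * Matrix.diagonal D * Lᵀ)
    (h : HasNegFrame M n) : n ≤ Fintype.card {i // D i < 0} :=
  (hasNegFrame_iff_card_neg_pivots hL hfac).1 (h.near_sub hE hrow hcol)

/-- PROVED — the same two bounds with EIGENVALUES of `P ± δ·1` in place of pivots (for a symmetric approximant; Weyl's
inequality in index form). [folklore] -/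
theorem card_neg_eigenvalues_sandwich_of_near {m n : ℕ} {M P E : Matrix (Fin m) (Fin m) ℝ} {δ : ℝ}
    (hE : ∀ i j, |M i j - P i j| ≤ E i j) (hrow : ∀ i, ∑ j, E i j ≤ δ) (hcol : ∀ j, ∑ i, E i j ≤ δ)
    (hadd : (P + δ • (1 : Matrix (Fin m) (Fin m) ℝ)).IsHermitian)
    (hsub : (P - δ • (1 : Matrix (Fin m) (Fin m) ℝ)).IsHermitian) :
    (n ≤ Fintype.card {i // hadd.eigenvalues i < 0} → HasNegFrame M n) ∧
      (HasNegFrame M n → n ≤ Fintype.card {i // hsub.eigenvalues i < 0}) :=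
  ⟨fun hn ↦ HasNegFrame.of_near_add hE hrow hcol ((hasNegFrame_iff_card_neg_eigenvalues hadd).2 hn),
    fun h ↦ (hasNegFrame_iff_card_neg_eigenvalues hsub).1 (h.near_sub hE hrow hcol)⟩

/-! ## §4 Dictionary: the index number of an enclosed window matrix -/

/-- **PROVED — at a window, lower:** enclosure + exact certificate of `k` negative pivots for `P + δ·1` ⇒
`k ≤ galerkinNegIndex d win` (every datum `d`). [folklore] -/
theorem natCast_le_galerkinNegIndex_of_near {d : Datum} {win : Window} {k : ℕ}
    {P E L : Matrix (Fin (win.N + 1)) (Fin (win.N + 1)) ℝ} {δ : ℝ} {D : Fin (win.N + 1) → ℝ}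
    (hE : ∀ i j, |d win i j - P i j| ≤ E i j) (hrow : ∀ i, ∑ j, E i j ≤ δ) (hcol : ∀ j, ∑ i, E i j ≤ δ)
    (hL : IsUnit L.det) (hfac : P + δ • (1 : Matrix _ _ ℝ) = L * Matrix.diagonal D * Lᵀ)
    (hk : k ≤ Fintype.card {i // D i < 0}) : (k : ℕ∞) ≤ galerkinNegIndex d win :=
  natCast_le_galerkinNegIndex_iff.2 (hasNegFrame_of_near_pivots hE hrow hcol hL hfac hk)

/-- **PROVED — at a window, upper:** enclosure + exact factorisation of `P − δ·1` ⇒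
`galerkinNegIndex d win ≤ #{negative pivots}`. [folklore] -/
theorem galerkinNegIndex_le_of_near {d : Datum} {win : Window}
    {P E L : Matrix (Fin (win.N + 1)) (Fin (win.N + 1)) ℝ} {δ : ℝ} {D : Fin (win.N + 1) → ℝ}
    (hE : ∀ i j, |d win i j - P i j| ≤ E i j) (hrow : ∀ i, ∑ j, E i j ≤ δ) (hcol : ∀ j, ∑ i, E i j ≤ δ)
    (hL : IsUnit L.det) (hfac : P - δ • (1 : Matrix _ _ ℝ) = L * Matrix.diagonal D * Lᵀ) :
    galerkinNegIndex d win ≤ (Fintype.card {i // D i < 0} : ℕ∞) :=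
  iSup_le fun _ ↦ iSup_le fun hn ↦ by exact_mod_cast le_card_neg_pivots_of_near hE hrow hcol hL hfac hn

/-- **PROVED — PINNING THE INDEX:** if both certificates count `k` (a gap of width `> 2δ` around `0` in the pivots
of `P`), then `galerkinNegIndex d win = k`. [folklore] -/
theorem galerkinNegIndex_eq_of_near {d : Datum} {win : Window} {k : ℕ}
    {P E L L' : Matrix (Fin (win.N + 1)) (Fin (win.N + 1)) ℝ} {δ : ℝ} {D D' : Fin (win.N + 1) → ℝ}
    (hE : ∀ i j, |d win i j - P i j| ≤ E i j) (hrow : ∀ i, ∑ j, E i j ≤ δ) (hcol : ∀ j, ∑ i, E i j ≤ δ)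
    (hL : IsUnit L.det) (hfac : P + δ • (1 : Matrix _ _ ℝ) = L * Matrix.diagonal D * Lᵀ)
    (hk : Fintype.card {i // D i < 0} = k)
    (hL' : IsUnit L'.det) (hfac' : P - δ • (1 : Matrix _ _ ℝ) = L' * Matrix.diagonal D' * L'ᵀ)
    (hk' : Fintype.card {i // D' i < 0} = k) : galerkinNegIndex d win = k :=
  le_antisymm (hk' ▸ galerkinNegIndex_le_of_near hE hrow hcol hL' hfac')
    (natCast_le_galerkinNegIndex_of_near hE hrow hcol hL hfac hk.ge)

/-- PROVED — the case `k = 0`: an enclosure and a factorisation of `P − δ·1` with NO negative pivot certify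
`WindowPositive (d win)` (cf. the level-1 certificates `GramCert` of the motivic-door cell, which bound `ε₁` itself).
[folklore] -/
theorem windowPositive_of_near {d : Datum} {win : Window}
    {P E L : Matrix (Fin (win.N + 1)) (Fin (win.N + 1)) ℝ} {δ : ℝ} {D : Fin (win.N + 1) → ℝ}
    (hE : ∀ i j, |d win i j - P i j| ≤ E i j) (hrow : ∀ i, ∑ j, E i j ≤ δ) (hcol : ∀ j, ∑ i, E i j ≤ δ)
    (hL : IsUnit L.det) (hfac : P - δ • (1 : Matrix _ _ ℝ) = L * Matrix.diagonal D * Lᵀ) (hD : ∀ i, 0 ≤ D i) :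
    WindowPositive (d win) := by
  rw [← galerkinNegIndex_eq_zero_iff, ← nonpos_iff_eq_zero]
  refine (galerkinNegIndex_le_of_near hE hrow hcol hL hfac).trans ?_
  have : Fintype.card {i // D i < 0} = 0 := Fintype.card_eq_zero_iff.2 ⟨fun ⟨i, hi⟩ ↦ (not_lt.2 (hD i)) hi⟩
  simp [this]

/-! ## §5 At `ζ`: finite data ⇒ a lower bound on `#𝒬` (no such data asserted) -/

/-- **PROVED — RH-free reading of a would-be index certificate at `ζ`:** an entrywise enclosure of the truncated even
block `A^{(N)}(a)` together with an exact unit-determinant factorisation of `P + δ·1` having `k` negative pivots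
proves `k ≤ #𝒬` (off-line zero quadruples), through GAL-4's unconditional ladder.  No enclosure of a `ζ` window with
a negative pivot is known or claimed; every certified window so far is positive (DATA elsewhere). [folklore] -/
theorem natCast_le_encard_of_near_pivots {win : Window} {k : ℕ}
    {P E L : Matrix (Fin (win.N + 1)) (Fin (win.N + 1)) ℝ} {δ : ℝ} {D : Fin (win.N + 1) → ℝ}
    (hE : ∀ i j, |zetaDatum win i j - P i j| ≤ E i j) (hrow : ∀ i, ∑ j, E i j ≤ δ) (hcol : ∀ j, ∑ i, E i j ≤ δ)
    (hL : IsUnit L.det) (hfac : P + δ • (1 : Matrix _ _ ℝ) = L * Matrix.diagonal D * Lᵀ)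
    (hk : k ≤ Fintype.card {i // D i < 0}) :
    (k : ℕ∞) ≤ {ρ : ℂ | ρ ∈ riemannZetaNontrivialZeros ∧ 1 / 2 < ρ.re ∧ 0 < ρ.im}.encard :=
  (natCast_le_galerkinNegIndex_of_near hE hrow hcol hL hfac hk).trans (galerkinNegIndex_le_encard win)

/-- PROVED — and the positive reading: an enclosure of `A^{(N)}(a)` plus a no-negative-pivot factorisation of `P − δ·1`
certifies `WindowPositive (zetaDatum win)` at that ONE window (a kernel upgrade path for single-window positivity DATA,
modulo the enclosure hypothesis). [folklore] -/
theorem zeta_windowPositive_of_near {win : Window}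
    {P E L : Matrix (Fin (win.N + 1)) (Fin (win.N + 1)) ℝ} {δ : ℝ} {D : Fin (win.N + 1) → ℝ}
    (hE : ∀ i j, |zetaDatum win i j - P i j| ≤ E i j) (hrow : ∀ i, ∑ j, E i j ≤ δ) (hcol : ∀ j, ∑ i, E i j ≤ δ)
    (hL : IsUnit L.det) (hfac : P - δ • (1 : Matrix _ _ ℝ) = L * Matrix.diagonal D * Lᵀ) (hD : ∀ i, 0 ≤ D i) :
    WindowPositive (zetaDatum win) :=
  windowPositive_of_near hE hrow hcol hL hfac hD

end Summit.RiemannHypothesis.RiemannHypothesis.Theorems.PfPersistence
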